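import Literature.Geometry.Lorentzian.CutBondiMass
import Literature.Geometry.Lorentzian.MinkowskiCauchyDevelopment
import Literature.Geometry.Lorentzian.MinkowskiGlobalHyperbolicity
import Literature.Geometry.Lorentzian.CauchyProblemProofs
import Literature.Geometry.Lorentzian.FlatDevelopment
import Literature.Geometry.Lorentzian.NullInfinity
import Literature.Geometry.Lorentzian.VisibleIncompleteNullRay
import Literature.Geometry.Lorentzian.CausalityPushUp
import Literature.Geometry.Lorentzian.TrivialDataAdmissible
import HarnessLib

/-!
# The future null cone of two kissing balls in Minkowski spacetime carries no round section
# family — a late compact visible set without cut energy (modulo maximality of Minkowski space)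

Construction request `defn-…LeafBudgetLawsR.Negative.ConeIrregularLateSetExists` (route
`FinalStateConjecture/MergerLatticeBudget`, crux `LeafBudgetLawsR`, item
stmt-FinalStateConjecture-14657). The negative lemma
`leafBudgetLawsR_false_of_coneIrregularLateSetExists`
(`Summits/FinalStateConjecture/FinalStateConjecture/Theorems/LeafBudgetLawsR/Negative/`) refutes the
crux modulo the hypothesis `ConeIrregularLateSetExists`: *some admissible datum has a maximal vacuum
Cauchy development with complete `𝓘⁺` containing a compact set `C ⊆ J⁺(ι X)` meeting the visible
region with `¬ HasCutBondiMass C m` for every `m`* (clause (i)(a) of the crux asks a cut energy of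
EVERY such `C`). This file constructs that object in the Minkowski development of the trivial data,
for an explicit `C`, proving everything except maximality of the Minkowski development, which is
carried as the hypothesis `hmax : Minkowski.vacuumCauchyDevelopment.IsMaximal` (main theorem
`Minkowski.exists_lateSet_forall_not_hasCutBondiMass_of_isMaximal`; its statement is the body of
`ConeIrregularLateSetExists` verbatim, with the summit-side `HasCompleteNullInfinity` unfolded, so
the refutation of `LeafBudgetLawsR` modulo `hmax` is a one-line `exact` on the summit side).

## The set and the theorem

`C = K :=` the **kissing balls** `{0} × (B̄(p, ρ) ∪ B̄(q, ρ))`, `q = p + 2ρ e`, `‖e‖ = 1`: two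
closed balls of the slice `{t = 0}` touching at one point (`Minkowski.kissingBalls`). The carrier of
`HasCutBondiMass K m` is a `CauchyDevelopment.RoundSectionFamily … K` (`CutBondiMass.lean`): smooth
spacelike embedded spheres `S_s ⊆ ∂J⁺(K)` with null normal pairs `(L, L̲)` whose outgoing leg `L` is
tangent to null geodesics running inside `∂J⁺(K)`, receding and asymptotically round.
**`Minkowski.isEmpty_roundSectionFamily_kissingBalls`: there is no such family — not even one such
sphere.** Hence `Minkowski.not_hasCutBondiMass_kissingBalls`.

## Proof (elementary; everything is proved here)

Write `d_c(z) = (‖z - c‖ - ρ)⁺` for the distance to the ball about `c` and `T = min (d_p, d_q)` for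
the **arrival time**. (1) `J⁺(K) = {x | T(x̲) ≤ x⁰}` (union of solid light cones,
`Minkowski.causalFuture_singleton`), so `∂J⁺(K) ⊆ {x⁰ = T(x̲)}` (`cone_kissingBalls_subset`). (2)
Geodesics of `η` are straight lines (`geodesic_eq_line`), so at each point `x` of a section the
field `tangent_L` yields a straight null segment `x + t L ⊆ ∂J⁺(K)`, `0 < t < ε`, `L` future null;
projected: `T(x̲ + s v) = T(x̲) + s` for small `s > 0`, `v = L̲/L⁰` a unit vector (`IsTangentRay`).
(3) `d_c` is `1`-Lipschitz along unit directions with equality only on outward radial rays from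
outside the ball (`eq_of_ballDist_add_smul_eq`, strict convexity of `ℝ³`); so no point of a section
is a crossing point `d_p = d_q` (`IsTangentRay.ballDist_ne`: the ray would be radial from both
centres), and on the side `{d_p < d_q}` every point satisfies `x⁰ + ρ = ‖x̲ - p‖`
(`IsTangentRay.le_norm_sub`). The section, a continuous image of `S²`, is connected, so it lies in
ONE open side, say that of `p`. (4) **A spacelike sphere on a light cone sees every direction**
(`exists_spatial_sub_eq_smul`): for a `C¹` map `f : S² → ℝ⁴` with `η`-spacelike differential and `f⁰
+ ρ = ‖f̲ - p‖ > 0`, every unit `u` is the direction `(f̲ y - p)/‖f̲ y - p‖` of some point. Indeed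
the direction cosine against `u` attains its maximum `η₀` on the compact sphere; if `|η₀| < 1`,
Fermat's theorem on the sphere (`fermat_sphere`, through the chart at the maximum) applied to `(x⁰ +
ρ)² - ‖x̲ - p‖²` and to `⟪u, x̲ - p⟫ - η₀(x⁰ + ρ)` shows that the spatial differential `W̲` maps the
tangent plane injectively — a kernel vector would be the null vector `0` or violate `W⁰ = ⟪ω₀, W̲⟫`
— into the plane `(u - η₀ ω₀)ᗮ ∋ ω₀` (`ω₀` the radial direction at the maximum), hence onto it
(equal finite dimensions), so `(1, ω₀) = W` is a NULL tangent vector — contradicting spacelikeness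
(`not_isMax_dirCosine`); `η₀ = -1` is reduced to the same lemma for a unit vector `u₂ ⊥ u`. (5) With
`u = e` (pointing from `p` to `q`) the point found in (4) is `x̲ = p + r e`, `r ≥ ρ`, where `d_q =
(|r - 2ρ| - ρ)⁺ ≤ r - ρ = d_p`, contradicting `d_p < d_q` (`side_false`); the side of `q` is
symmetric (`u = -e`). ∎ — Geometrically: the generator of `∂J⁺(K)` leaving the ball about `p` at the
contact point towards `q` enters the interior of `J⁺(K)` immediately, while a closed spacelike
section of the `p`-side, projecting onto the whole sphere of generator directions, would have to
cross it. The obstruction is first order and topological; the refuter's witness (a short spacelike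
SEGMENT, whose cone is `C¹` but not `C²` across the junction generators) needs a second-order
argument and is not formalised here.

The remaining clauses: `K` is compact, lies in `ι(ℝ³) ⊆ J⁺(ι ℝ³)`, and its point `(0, q)` is visible
— it lies in `I⁻` of the point `(2ρ, q)` of the complete normalised null ray `s ↦ (s, p + s e)`
(`isNormalisedNullRayFrom_nullRay`, `ofTimeSpace_mem_visibleRegion`); the Minkowski development has
complete future null infinity in the sojourn sense
(`hasCompleteFutureNullInfinity_vacuumCauchyDevelopment`, null geodesic completeness + uniqueness of
geodesics); `trivialData` is admissible (`TrivialDataAdmissible.lean`).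

## What is NOT here

* Maximality of the Minkowski development (`hmax`). It is the existence half of
  Choquet-Bruhat–Geroch 1969, Thm. 3, at flat data (every vacuum Cauchy development of `(ℝ³, δ, 0)`
  embeds into `ℝ⁴₁`: hyperbolic uniqueness for the vacuum equations), not provable at the pin; MGHD
  existence in general is the named fact `choquetBruhat_geroch_exists_mghd_cauchy`
  (`CauchyProblemMGHDExistence.lean`). Every refutation at the trivial datum in summit
  `FinalStateConjecture` is modulo this same hypothesis.
* No statement about Hawking masses, areas or roundness is needed or made: the carrier is empty.

## Typing notes

The carrier of `Minkowski.vacuumCauchyDevelopment` is `E4`, its model `𝓡 (3 + 1)`, its metric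
`Minkowski.smoothMetric` — each by `rfl` only. Accordingly: subsets of the development are handled
through the `Set E4`-valued wrappers `coneFuture`/`cone` and `(… : Set E4)` ascriptions; sections
are handled as maps `f : S² → E4` with `ContMDiff (𝓡 2) 𝓘(ℝ, E4)` and `mfderiv (𝓡 2) 𝓘(ℝ, E4)` (the
fields of a `RoundSectionFamily` convert by `rfl`); geodesic statements are over
`Minkowski.smoothMetric`, the Levi-Civita instance being re-registered in that form where needed.
Mathlib (at the pin) has no Lorentzian causality; used from Mathlib: the manifold structure of the
sphere (`Instances.Sphere`), `mfderiv` calculus, `IsLocalMax.fderiv_eq_zero`,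
`Submodule.finrank_orthogonal_span_singleton`,
`LinearMap.injective_iff_surjective_of_finrank_eq_finrank`, `norm_add_eq_iff_real`,
`inner_eq_norm_mul_iff_real`, `isPreconnected_sphere`.

## References

* B. O'Neill, *Semi-Riemannian Geometry with Applications to Relativity*, Academic Press 1983: Ch.
  3, p. 55 (`ℝ⁴₁`) and Example 25 (geodesics of `ℝⁿᵥ` are straight lines); Ch. 14, p. 402 (`I⁺`,
  `J⁺` in Minkowski space). [ONeill1983, ONeillSemiRiemannian1983]
* S. W. Hawking, G. F. R. Ellis, *The Large Scale Structure of Space-Time*, CUP 1973, §6.3 (achronal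
  boundaries are generated by null geodesics with past endpoints on the set and future endpoints
  where generators cross). [HawkingEllis1973]
* D. Christodoulou, *On the global initial value problem and the issue of singularities*, CQG 16
  (1999) A23, pp. A26–A27 (normalised null rays; completeness of `𝓘⁺`; Minkowski space).
  [Christodoulou1999]
* R. M. Wald, *General Relativity*, Chicago 1984, §12.1, p. 300 (`I⁻(𝓘⁺)`, the black hole region).
  [Wald1984GR]
* D. Christodoulou, S. Klainerman, *The Global Nonlinear Stability of the Minkowski Space*,
  Princeton 1993, Ch. 17 (Hawking mass of round sections and the Bondi mass; the carrier
  `RoundSectionFamily` of `CutBondiMass.lean`). [ChristodoulouKlainerman1993PMS41]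
* Y. Choquet-Bruhat, R. Geroch, Comm. Math. Phys. 14 (1969) 329–335, Thm. 3 (MGHD).
  [ChoquetBruhatGeroch1969CMP]
-/

open Set Metric Filter Manifold Bundle
open scoped Topology Manifold ContDiff InnerProductSpace

noncomputable section

namespace Literature.Geometry.Lorentzian

namespace Minkowski

/-! ### Excess distance to a ball and the arrival time of the kissing balls -/

/-- The **excess distance** `(‖z - c‖ - ρ)⁺` from the point `z ∈ ℝ³` to the closed Euclidean ball
of radius `ρ` about `c` (for `ρ ≥ 0` it is the distance to that ball,
`exists_mem_closedBall_norm_sub_eq`, `ballDist_le_norm_sub`). [folklore] -/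
def ballDist (ρ : ℝ) (c z : E3) : ℝ := max (‖z - c‖ - ρ) 0

/-- The excess distance is nonnegative. [folklore] -/
theorem ballDist_nonneg (ρ : ℝ) (c z : E3) : 0 ≤ ballDist ρ c z := le_max_right _ _

/-- `‖z - c‖ - ρ ≤ (‖z - c‖ - ρ)⁺`. [folklore] -/
theorem norm_sub_sub_le_ballDist (ρ : ℝ) (c z : E3) : ‖z - c‖ - ρ ≤ ballDist ρ c z :=
  le_max_left _ _

/-- Outside the ball the excess distance is `‖z - c‖ - ρ`. [folklore] -/
theorem ballDist_of_le {ρ : ℝ} {c z : E3} (h : ρ ≤ ‖z - c‖) : ballDist ρ c z = ‖z - c‖ - ρ :=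
  max_eq_left (sub_nonneg.2 h)

/-- On the ball the excess distance vanishes. [folklore] -/
theorem ballDist_of_ge {ρ : ℝ} {c z : E3} (h : ‖z - c‖ ≤ ρ) : ballDist ρ c z = 0 :=
  max_eq_right (sub_nonpos.2 h)

/-- The excess distance is continuous. [folklore] -/
theorem continuous_ballDist (ρ : ℝ) (c : E3) : Continuous (ballDist ρ c) := by
  unfold ballDist; fun_prop

/-- Every point of the ball is at distance at least the excess distance. [folklore] -/
theorem ballDist_le_norm_sub {ρ : ℝ} {c z w : E3} (hw : w ∈ closedBall c ρ) :
    ballDist ρ c z ≤ ‖z - w‖ := by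
  refine max_le ?_ (norm_nonneg _)
  rw [mem_closedBall, dist_eq_norm] at hw
  have := norm_sub_le_norm_sub_add_norm_sub z w c
  linarith

/-- The excess distance is attained: by `z` itself on the ball, by the radial projection
`c + (ρ/‖z - c‖)(z - c)` outside it (`ρ ≥ 0`). [folklore] -/
theorem exists_mem_closedBall_norm_sub_eq {ρ : ℝ} (hρ : 0 ≤ ρ) (c z : E3) :
    ∃ w ∈ closedBall c ρ, ‖z - w‖ = ballDist ρ c z := by
  by_cases h : ‖z - c‖ ≤ ρ
  · refine ⟨z, ?_, ?_⟩
    · rwa [mem_closedBall, dist_eq_norm]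
    · rw [sub_self, norm_zero, ballDist_of_ge h]
  · rw [not_le] at h
    have hr : 0 < ‖z - c‖ := hρ.trans_lt h
    refine ⟨c + (ρ / ‖z - c‖) • (z - c), ?_, ?_⟩
    · rw [mem_closedBall, dist_eq_norm, add_sub_cancel_left, norm_smul, Real.norm_eq_abs,
        abs_of_nonneg (by positivity), div_mul_cancel₀ _ hr.ne']
    · have : z - (c + (ρ / ‖z - c‖) • (z - c)) = (1 - ρ / ‖z - c‖) • (z - c) := by
        rw [sub_smul, one_smul]; abel
      rw [this, norm_smul, Real.norm_eq_abs, abs_of_nonneg, sub_mul, one_mul,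
        div_mul_cancel₀ _ hr.ne', ballDist_of_le h.le]
      rw [sub_nonneg, div_le_one hr]; exact h.le

/-- The excess distance is `1`-Lipschitz along unit directions: `d(z + s v) ≤ d(z) + s` for
`‖v‖ = 1`, `s ≥ 0` (triangle inequality). [folklore] -/
theorem ballDist_add_smul_le (ρ : ℝ) (c z : E3) {v : E3} (hv : ‖v‖ = 1) {s : ℝ} (hs : 0 ≤ s) :
    ballDist ρ c (z + s • v) ≤ ballDist ρ c z + s := by
  refine max_le ?_ (by linarith [ballDist_nonneg ρ c z])
  have h1 : ‖z + s • v - c‖ ≤ ‖z - c‖ + s := by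
    calc ‖z + s • v - c‖ = ‖(z - c) + s • v‖ := by congr 1; abel
      _ ≤ ‖z - c‖ + ‖s • v‖ := norm_add_le _ _
      _ = ‖z - c‖ + s := by rw [norm_smul, hv, mul_one, Real.norm_eq_abs, abs_of_nonneg hs]
  linarith [norm_sub_sub_le_ballDist ρ c z]

/-- **Equality in the Lipschitz bound singles out the outward radial ray from outside the ball**:
if `d(z + s v) = d(z) + s` for some `s > 0` and a unit vector `v`, then `ρ ≤ ‖z - c‖` and
`v = (z - c)/‖z - c‖` (equality in the triangle inequality in the strictly convex space `ℝ³`,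
`norm_add_eq_iff_real`). [folklore] -/
theorem eq_of_ballDist_add_smul_eq {ρ : ℝ} (hρ : 0 < ρ) {c z v : E3} (hv : ‖v‖ = 1) {s : ℝ}
    (hs : 0 < s) (h : ballDist ρ c (z + s • v) = ballDist ρ c z + s) :
    ρ ≤ ‖z - c‖ ∧ v = ‖z - c‖⁻¹ • (z - c) := by
  have hpos : 0 < ballDist ρ c (z + s • v) := by
    rw [h]; linarith [ballDist_nonneg ρ c z]
  have hL : ballDist ρ c (z + s • v) = ‖z + s • v - c‖ - ρ := by
    unfold ballDist at hpos ⊢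
    rcases le_total (‖z + s • v - c‖ - ρ) 0 with h0 | h0
    · rw [max_eq_right h0] at hpos; exact (lt_irrefl _ hpos).elim
    · exact max_eq_left h0
  have htri : ‖(z - c) + s • v‖ ≤ ‖z - c‖ + ‖s • v‖ := norm_add_le _ _
  have hsv : ‖s • v‖ = s := by rw [norm_smul, hv, mul_one, Real.norm_eq_abs, abs_of_pos hs]
  have hzc : z + s • v - c = (z - c) + s • v := by abel
  rw [hzc] at hL
  have hge := norm_sub_sub_le_ballDist ρ c z
  have heq1 : ballDist ρ c z = ‖z - c‖ - ρ := by linarith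
  have hρle : ρ ≤ ‖z - c‖ := by linarith [ballDist_nonneg ρ c z]
  have heq2 : ‖(z - c) + s • v‖ = ‖z - c‖ + ‖s • v‖ := by linarith
  refine ⟨hρle, ?_⟩
  have hr : 0 < ‖z - c‖ := hρ.trans_le hρle
  rw [norm_add_eq_iff_real, hsv] at heq2
  -- heq2 : s • (z - c) = ‖z - c‖ • s • v
  rw [smul_smul] at heq2
  have : v = (‖z - c‖ * s)⁻¹ • (s • (z - c)) := by
    rw [heq2, smul_smul, inv_mul_cancel₀ (by positivity), one_smul]
  rw [this, smul_smul, mul_inv, mul_assoc, inv_mul_cancel₀ hs.ne', mul_one]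

/-- The **kissing balls**: the compact set `{0} × (B̄(p, ρ) ∪ B̄(q, ρ)) ⊆ ℝ⁴` of Minkowski
spacetime, two closed balls of radius `ρ` in the slice `{t = 0}` (externally tangent when
`‖p - q‖ = 2ρ`, the case of interest). [folklore] -/
def kissingBalls (ρ : ℝ) (p q : E3) : Set E4 :=
  E4.ofTimeSpace 0 '' (closedBall p ρ ∪ closedBall q ρ)

/-- The **arrival time** `T(z) = min (d_p z) (d_q z)` of the kissing balls at the spatial point
`z`: the least Euclidean distance from `z` to the two balls, i.e. the time at which the future null
cone of the kissing balls passes over `z` (`coneFuture_kissingBalls`). [folklore] -/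
def arrival (ρ : ℝ) (p q : E3) (z : E3) : ℝ := min (ballDist ρ p z) (ballDist ρ q z)

/-- The arrival time is continuous. [folklore] -/
theorem continuous_arrival (ρ : ℝ) (p q : E3) : Continuous (arrival ρ p q) :=
  (continuous_ballDist ρ p).min (continuous_ballDist ρ q)

/-- The kissing balls are compact (a continuous image of two closed balls of `ℝ³`). [folklore] -/
theorem isCompact_kissingBalls (ρ : ℝ) (p q : E3) : IsCompact (kissingBalls ρ p q) :=
  ((isCompact_closedBall p ρ).union (isCompact_closedBall q ρ)).image (E4.continuous_ofTimeSpace 0)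

/-- The causal future `J⁺(K)` in the Minkowski development `Minkowski.vacuumCauchyDevelopment`, as a
subset of `E4`. The carrier of that development is `E4` by `rfl` only, so this wrapper (and `cone`)
fixes the ambient type once; all statements below are about subsets of `E4`, and the fields of a
`RoundSectionFamily` convert to them by `rfl`. O'Neill 1983, Ch. 14, p. 402 (`J⁺`). [cite:
ONeillSemiRiemannian1983, Ch. 14, p. 402] -/
def coneFuture (K : Set E4) : Set E4 :=
  Minkowski.vacuumCauchyDevelopment.metric.causalFuture
    Minkowski.vacuumCauchyDevelopment.timeOrientation K

/-- The **future null cone** `∂J⁺(K) = frontier J⁺(K)` of `K` in the Minkowski development, as a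
subset of `E4` — the carrier of the sections of a `CauchyDevelopment.RoundSectionFamily … K`
(`CutBondiMass.lean`). [folklore] -/
def cone (K : Set E4) : Set E4 := frontier (coneFuture K)

/-- Unfolding lemma for `cone` (by `rfl`). [folklore] -/
theorem cone_def (K : Set E4) :
    cone K = frontier (Minkowski.vacuumCauchyDevelopment.metric.causalFuture
      Minkowski.vacuumCauchyDevelopment.timeOrientation K) := rfl

/-- **The causal future of the kissing balls is the supergraph of the arrival time**: `x ∈ J⁺(K) ↔
T(x̲) ≤ x⁰`. From `J⁺(K) = ⋃_{k ∈ K} J⁺(k)` and the solid light cones `J⁺(k) = {‖x̲ - k̲‖ ≤ x⁰ -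
k⁰}` of Minkowski spacetime (`Minkowski.causalFuture_singleton`; O'Neill 1983, Ch. 14, p. 402), the
distance to a ball being attained. [cite: ONeillSemiRiemannian1983, Ch. 14, p. 402] -/
theorem mem_coneFuture_kissingBalls_iff {ρ : ℝ} (hρ : 0 ≤ ρ) (p q : E3) (x : E4) :
    x ∈ coneFuture (kissingBalls ρ p q) ↔ arrival ρ p q (E4.spatial x) ≤ x 0 := by
  have hU := Set.ext_iff.1 (LorentzianMetric.causalFuture_eq_biUnion
    (g := Minkowski.vacuumCauchyDevelopment.metric)
    (τ := Minkowski.vacuumCauchyDevelopment.timeOrientation) (kissingBalls ρ p q)) x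
  have hsing : ∀ w : E3, x ∈ coneFuture {E4.ofTimeSpace 0 w} ↔ ‖E4.spatial x - w‖ ≤ x 0 :=
      fun w ↦ by
    have h := (Set.ext_iff.1 (causalFuture_singleton (E4.ofTimeSpace 0 w)) x)
    simp only [mem_setOf_eq, E4.spatial_ofTimeSpace, E4.ofTimeSpace_apply_zero, sub_zero] at h
    exact h
  constructor
  · intro hx
    obtain ⟨k, hk, hxk⟩ := Set.mem_iUnion₂.1 (hU.1 hx)
    obtain ⟨w, hw, rfl⟩ := hk
    have hx' : ‖E4.spatial x - w‖ ≤ x 0 := (hsing w).1 hxk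
    rcases hw with hw | hw
    · exact (min_le_left _ _).trans ((ballDist_le_norm_sub hw).trans hx')
    · exact (min_le_right _ _).trans ((ballDist_le_norm_sub hw).trans hx')
  · intro hx
    have key : ∀ c : E3, ballDist ρ c (E4.spatial x) ≤ x 0 → (c = p ∨ c = q) →
        ∃ w ∈ closedBall p ρ ∪ closedBall q ρ, x ∈ coneFuture {E4.ofTimeSpace 0 w} := by
      intro c hc hcpq
      obtain ⟨w, hw, hw'⟩ := exists_mem_closedBall_norm_sub_eq hρ c (E4.spatial x)
      refine ⟨w, ?_, (hsing w).2 (hw'.symm ▸ hc)⟩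
      rcases hcpq with rfl | rfl
      · exact Or.inl hw
      · exact Or.inr hw
    have : ∃ w ∈ closedBall p ρ ∪ closedBall q ρ, x ∈ coneFuture {E4.ofTimeSpace 0 w} := by
      rcases min_le_iff.1 hx with h | h
      · exact key p h (Or.inl rfl)
      · exact key q h (Or.inr rfl)
    obtain ⟨w, hw, hxw⟩ := this
    exact hU.2 (Set.mem_iUnion₂.2 ⟨E4.ofTimeSpace 0 w, ⟨w, hw, rfl⟩, hxw⟩)

/-- `J⁺(K) = {x | T(x̲) ≤ x⁰}` for the kissing balls `K` (set form of
`mem_coneFuture_kissingBalls_iff`). [cite: ONeillSemiRiemannian1983, Ch. 14, p. 402] -/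
theorem coneFuture_kissingBalls {ρ : ℝ} (hρ : 0 ≤ ρ) (p q : E3) :
    coneFuture (kissingBalls ρ p q) = {x : E4 | arrival ρ p q (E4.spatial x) ≤ x 0} :=
  Set.ext fun x ↦ mem_coneFuture_kissingBalls_iff hρ p q x

/-- **The future null cone of the kissing balls lies on the graph of the arrival time**: `∂J⁺(K) ⊆
{x | T(x̲) = x⁰}` (the frontier of `{f ≤ g}` lies in `{f = g}` for continuous `f, g`). Only this
inclusion is used below. [folklore] -/
theorem cone_kissingBalls_subset {ρ : ℝ} (hρ : 0 ≤ ρ) (p q : E3) :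
    cone (kissingBalls ρ p q) ⊆ {x : E4 | arrival ρ p q (E4.spatial x) = x 0} := by
  rw [cone, coneFuture_kissingBalls hρ]
  refine frontier_le_subset_eq ((continuous_arrival ρ p q).comp E4.spatial.continuous) ?_
  exact (EuclideanSpace.proj (𝕜 := ℝ) (0 : Fin 4)).continuous

/-! ### Tangent rays of the arrival time -/

/-- `v` is a **tangent ray direction of the arrival time at `z`**: `T(z + s v) = T(z) + s` for all
small `s > 0`. This is what a straight null segment `x + t L`, `0 < t < ε`, lying on the cone `{x⁰ =
T(x̲)}` projects to (`v = L̲/L⁰`), see `isEmpty_roundSectionFamily_kissingBalls`. [folklore] -/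
def IsTangentRay (ρ : ℝ) (p q z v : E3) : Prop :=
  ∃ δ : ℝ, 0 < δ ∧ ∀ s ∈ Ioo 0 δ, arrival ρ p q (z + s • v) = arrival ρ p q z + s

/-- **No tangent ray issues from a crossing point.** If `p ≠ q` and the excess distances to the two
balls agree at `z`, no unit `v` is a tangent ray direction at `z`: along a tangent ray both excess
distances would grow at unit rate, forcing `v` to be the outward radial direction from BOTH centres
with equal radii, whence `p = q`. (Geometrically: the generators of `∂J⁺(K)` through a crossing
point have their future endpoint there; Hawking–Ellis 1973, §6.3.) [folklore] -/
theorem IsTangentRay.ballDist_ne {ρ : ℝ} (hρ : 0 < ρ) {p q z v : E3} (hpq : p ≠ q) (hv : ‖v‖ = 1)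
    (h : IsTangentRay ρ p q z v) : ballDist ρ p z ≠ ballDist ρ q z := by
  intro heq
  obtain ⟨δ, hδ, hs⟩ := h
  have hs' := hs (δ / 2) ⟨by positivity, by linarith⟩
  set s := δ / 2 with hs_def
  have hs0 : 0 < s := by positivity
  have ha : arrival ρ p q z = ballDist ρ p z := by rw [arrival, heq, min_self]
  have hp_le := ballDist_add_smul_le ρ p z hv hs0.le
  have hq_le := ballDist_add_smul_le ρ q z hv hs0.le
  have hp_eq : ballDist ρ p (z + s • v) = ballDist ρ p z + s := by
    have := min_le_left (ballDist ρ p (z + s • v)) (ballDist ρ q (z + s • v))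
    rw [arrival] at hs'; rw [ha] at hs'; linarith
  have hq_eq : ballDist ρ q (z + s • v) = ballDist ρ q z + s := by
    have := min_le_right (ballDist ρ p (z + s • v)) (ballDist ρ q (z + s • v))
    rw [arrival] at hs'; rw [ha] at hs'; linarith
  obtain ⟨hρp, hvp⟩ := eq_of_ballDist_add_smul_eq hρ hv hs0 hp_eq
  obtain ⟨hρq, hvq⟩ := eq_of_ballDist_add_smul_eq hρ hv hs0 hq_eq
  have hr : ‖z - p‖ = ‖z - q‖ := by
    rw [ballDist_of_le hρp, ballDist_of_le hρq] at heq; linarith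
  have hp0 : 0 < ‖z - p‖ := hρ.trans_le hρp
  have h1 : z - p = ‖z - p‖ • v := by rw [hvp, smul_smul, mul_inv_cancel₀ hp0.ne', one_smul]
  have h2 : z - q = ‖z - q‖ • v := by
    rw [hvq, smul_smul, mul_inv_cancel₀ (hr ▸ hp0).ne', one_smul]
  apply hpq
  have : z - p = z - q := by rw [h1, h2, hr]
  simpa using this

/-- On the side of the ball about `p` (`d_p z < d_q z`), a point `z` carrying a tangent ray lies
outside that ball, `ρ ≤ ‖z - p‖` — so that `T = ‖· - p‖ - ρ` there, the light cone of the ball — and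
the ray is the outward radial one. [folklore] -/
theorem IsTangentRay.le_norm_sub {ρ : ℝ} (hρ : 0 < ρ) {p q z v : E3} (hv : ‖v‖ = 1)
    (h : IsTangentRay ρ p q z v) (hlt : ballDist ρ p z < ballDist ρ q z) :
    ρ ≤ ‖z - p‖ ∧ v = ‖z - p‖⁻¹ • (z - p) := by
  obtain ⟨δ, hδ, hs⟩ := h
  set s := δ / 2 with hs_def
  have hs0 : 0 < s := by positivity
  have hs' := hs s ⟨hs0, by simp only [hs_def]; linarith⟩
  have ha : arrival ρ p q z = ballDist ρ p z := by rw [arrival, min_eq_left hlt.le]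
  have hp_le := ballDist_add_smul_le ρ p z hv hs0.le
  have hp_eq : ballDist ρ p (z + s • v) = ballDist ρ p z + s := by
    have := min_le_left (ballDist ρ p (z + s • v)) (ballDist ρ q (z + s • v))
    rw [arrival] at hs'; rw [ha] at hs'; linarith
  exact eq_of_ballDist_add_smul_eq hρ hv hs0 hp_eq

/-- The arrival time is symmetric in the two balls. [folklore] -/
theorem arrival_comm (ρ : ℝ) (p q z : E3) : arrival ρ p q z = arrival ρ q p z := min_comm _ _

/-- Tangent rays do not depend on the order of the two balls. [folklore] -/
theorem IsTangentRay.symm {ρ : ℝ} {p q z v : E3} (h : IsTangentRay ρ p q z v) :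
    IsTangentRay ρ q p z v := by
  obtain ⟨δ, hδ, hs⟩ := h
  exact ⟨δ, hδ, fun s hs' ↦ by rw [arrival_comm, hs s hs', arrival_comm]⟩

/-! ### Null geodesics of the Minkowski development are straight null lines -/

/-- `η(v, v) = -(v⁰)² + ‖v̲‖²` (O'Neill 1983, Ch. 3, p. 55). [cite: ONeill1983, Ch. 3, p. 55] -/
theorem bilin_self_eq (v : E4) : bilin v v = -(v 0) ^ 2 + ‖E4.spatial v‖ ^ 2 := by
  rw [bilin_apply, EuclideanSpace.real_norm_sq_eq]
  simp [pow_two]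

/-- **Geodesics of Minkowski spacetime are affinely parametrised straight lines** (O'Neill 1983,
Ch. 3, Example 25), in the form used here: a geodesic of the Levi-Civita connection of `η` on
`(-ε, ε)` with position `x` and velocity `v` at `0` equals `t ↦ x + t v` there (the line is a
geodesic, `ModelSpace.isGeodesic_line`; uniqueness, `PseudoRiemannianMetric.eqOn_of_isGeodesicOn`).
Stated for `Minkowski.smoothMetric`, which is the metric of `Minkowski.vacuumCauchyDevelopment` by
`rfl`. [cite: ONeill1983, Ch. 3, Example 3.25] -/
theorem geodesic_eq_line {γ : ℝ → E4} {ε : ℝ} (hε : 0 < ε)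
    (hγ : IsGeodesicOn
      (haveI := Minkowski.smoothMetric.toPseudoRiemannianMetric.hasLeviCivita
       Minkowski.smoothMetric.toPseudoRiemannianMetric.leviCivita) γ (Ioo (-ε) ε))
    {x v : E4} (hx : γ 0 = x) (hv : velocity 𝓘(ℝ, E4) γ 0 = v) {t : ℝ} (ht : t ∈ Ioo (-ε) ε) :
    γ t = x + t • v := by
  haveI := Minkowski.smoothMetric.toPseudoRiemannianMetric.hasLeviCivita
  have hline : IsGeodesic Minkowski.smoothMetric.toPseudoRiemannianMetric.leviCivita
      (fun s : ℝ ↦ x + s • v) :=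
    ModelSpace.isGeodesic_line smoothMetric_val x v
  have h := PseudoRiemannianMetric.eqOn_of_isGeodesicOn
    (g := Minkowski.smoothMetric.toPseudoRiemannianMetric)
    isOpen_Ioo ordConnected_Ioo hγ (hline.mono (subset_univ _)) (t₀ := 0)
    ⟨by linarith, hε⟩ (by simp [hx]) (hv.trans (ModelSpace.velocity_line x v 0).symm)
  exact h ht

/-! ### What a round section family hands us, point by point -/

variable {K : Set E4}

/-- **What a round section family on `∂J⁺(K)` in Minkowski spacetime hands us, point by point.** At
a point `y` of the section `S_s`: the point `x = S_s(y) ∈ ∂J⁺(K)`, the outgoing null normal `L`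
there — a future null vector, `η(L, L) = 0`, `L⁰ > 0` — and, because `L` is tangent to a null
geodesic generator running inside `∂J⁺(K)` (field `tangent_L`) and geodesics are straight lines
(`geodesic_eq_line`), the straight null segment `x + t L`, `0 < t < ε`, inside `∂J⁺(K)`. Only the
fields `range_sec_subset`, `pair` and `tangent_L` are used. [folklore] -/
theorem exists_pointData
    (𝓕 : CauchyDevelopment.RoundSectionFamily
      Minkowski.vacuumCauchyDevelopment.toCauchyDevelopment K)
    (s : ℝ) (y : sphere (0 : E3) 1) :
    ∃ x L : E4, x = 𝓕.sec s y ∧ L = (𝓕.pair s).L y ∧ x ∈ cone K ∧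
      (∃ ε : ℝ, 0 < ε ∧ ∀ t ∈ Ioo 0 ε, x + t • L ∈ cone K) ∧
      bilin L L = 0 ∧ 0 < L 0 := by
  obtain ⟨x, hx⟩ : ∃ x : E4, x = 𝓕.sec s y := ⟨_, rfl⟩
  obtain ⟨L, hL⟩ : ∃ L : E4, L = (𝓕.pair s).L y := ⟨_, rfl⟩
  refine ⟨x, L, hx, hL, hx ▸ 𝓕.range_sec_subset s ⟨y, rfl⟩, ?_, ?_, ?_⟩
  · obtain ⟨γ, ε, hε, hγ, h0, hv, hmem⟩ := 𝓕.tangent_L s y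
    refine ⟨ε, hε, fun t ht ↦ ?_⟩
    have hline := geodesic_eq_line hε hγ (x := x) (v := L) (h0.trans hx.symm)
      (hv.trans hL.symm) ⟨by linarith [ht.1], ht.2⟩
    exact hline ▸ hmem t ht
  · have h1 := ((𝓕.pair s).isNull_L y).1
    rw [hL]; exact h1
  · have h2 := ((𝓕.pair s).isFutureDirected_L y).2
    have h2' : bilin (E4.basisVector 0) L < 0 := by rw [hL]; exact h2
    rw [bilin_basisVector_zero_left] at h2'
    linarith



/-! ### Fermat's principle for functions of a smooth sphere in `E4` -/

/-- **Fermat's theorem on the sphere.** If `Φ ∘ f` attains its maximum over `S²` at `y₀`, where `f :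
S² → ℝ⁴` is `C¹` and `Φ` is differentiable at `f y₀` with derivative `Φ'`, then `Φ'` kills the image
of the differential of `f` at `y₀`: read in the chart at `y₀` the composite has a maximum at an
interior point, so its Fréchet derivative — which is `mfderiv (Φ ∘ f) y₀ = Φ' ∘ mfderiv f y₀` —
vanishes. [folklore] -/
theorem fermat_sphere {f : sphere (0 : E3) 1 → E4} (hf : ContMDiff (𝓡 2) 𝓘(ℝ, E4) 1 f)
    {Φ : E4 → ℝ} {Φ' : E4 →L[ℝ] ℝ} {y₀ : sphere (0 : E3) 1} (hΦ : HasFDerivAt Φ Φ' (f y₀))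
    (hmax : ∀ y, Φ (f y) ≤ Φ (f y₀)) (w : EuclideanSpace ℝ (Fin 2)) :
    Φ' (mfderiv (𝓡 2) 𝓘(ℝ, E4) f y₀ w) = 0 := by
  have hfd : MDifferentiableAt (𝓡 2) 𝓘(ℝ, E4) f y₀ := hf.mdifferentiableAt one_ne_zero
  have hΦd : MDifferentiableAt 𝓘(ℝ, E4) 𝓘(ℝ, ℝ) Φ (f y₀) :=
    mdifferentiableAt_iff_differentiableAt.mpr hΦ.differentiableAt
  have hcomp : mfderiv (𝓡 2) 𝓘(ℝ, ℝ) (Φ ∘ f) y₀ =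
      (mfderiv 𝓘(ℝ, E4) 𝓘(ℝ, ℝ) Φ (f y₀)).comp (mfderiv (𝓡 2) 𝓘(ℝ, E4) f y₀) :=
    mfderiv_comp y₀ hΦd hfd
  have hzero : mfderiv (𝓡 2) 𝓘(ℝ, ℝ) (Φ ∘ f) y₀ = 0 := by
    have hd : MDifferentiableAt (𝓡 2) 𝓘(ℝ, ℝ) (Φ ∘ f) y₀ := hΦd.comp y₀ hfd
    rw [hd.mfderiv]
    have hw : writtenInExtChartAt (𝓡 2) 𝓘(ℝ, ℝ) y₀ (Φ ∘ f) =
        (Φ ∘ f) ∘ (extChartAt (𝓡 2) y₀).symm := by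
      ext z; simp [writtenInExtChartAt]
    rw [hw, ModelWithCorners.range_eq_univ, fderivWithin_univ]
    apply IsLocalMax.fderiv_eq_zero
    refine Filter.Eventually.of_forall fun z ↦ ?_
    show Φ (f ((extChartAt (𝓡 2) y₀).symm z)) ≤ Φ (f ((extChartAt (𝓡 2) y₀).symm _))
    rw [extChartAt_to_inv]
    exact hmax _
  have h := congrArg (fun T : TangentSpace (𝓡 2) y₀ →L[ℝ] TangentSpace 𝓘(ℝ, ℝ) (Φ (f y₀)) ↦ T w)
    hcomp
  simp only [hzero, ContinuousLinearMap.comp_apply, mfderiv_eq_fderiv, hΦ.fderiv] at h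
  exact h.symm

/-- **No interior critical direction.** Let `f : S² → ℝ⁴` be `C¹` with `η`-spacelike differential
(`η(df w, df w) > 0` for `w ≠ 0`), lying on the future light cone of the ball of radius `ρ` about
`c`: `f⁰ + ρ = ‖f̲ - c‖ > 0`. Then the direction cosine `y ↦ ⟪u, f̲ y - c⟫ / ‖f̲ y - c‖` against a
unit vector `u` cannot attain its maximum at a point `y₀` where its value `η₀` lies in `(-1, 1)`.
Proof: with `ω₀ = (f̲ y₀ - c)/‖f̲ y₀ - c‖`, Fermat's theorem applied to `(x⁰ + ρ)² - ‖x̲ - c‖²`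
(which vanishes on `f`) and to `⟪u, x̲ - c⟫ - η₀ (x⁰ + ρ)` (which is `≤ 0` on `f`, `= 0` at `y₀`)
gives, for every tangent image `W = df w`: `W⁰ = ⟪ω₀, W̲⟫` and `⟪u - η₀ ω₀, W̲⟫ = 0`. So `w ↦ W̲`
maps `ℝ²` into the plane `(u - η₀ ω₀)ᗮ` (`u - η₀ ω₀ ≠ 0` as `|η₀| < 1`), injectively (a kernel
vector would have `W̲ = 0`, hence `W⁰ = 0`, contradicting spacelikeness), hence onto; but `ω₀` lies
in that plane, so `ω₀ = W̲` for some `w ≠ 0`, whose `W⁰ = ⟪ω₀, ω₀⟫ = 1` makes `W = (1, ω₀)` null: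
`η(W, W) = 0 < η(W, W)`. (In words: the tangent plane of a spacelike surface inside a null cone
cannot contain the generator.) [folklore] -/
theorem not_isMax_dirCosine {f : sphere (0 : E3) 1 → E4} (hf : ContMDiff (𝓡 2) 𝓘(ℝ, E4) 1 f)
    (hpos : ∀ y (w : EuclideanSpace ℝ (Fin 2)), w ≠ 0 →
      0 < bilin (mfderiv (𝓡 2) 𝓘(ℝ, E4) f y w) (mfderiv (𝓡 2) 𝓘(ℝ, E4) f y w))
    {c : E3} {ρ : ℝ} (hcone : ∀ y, f y 0 + ρ = ‖E4.spatial (f y) - c‖)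
    (hr : ∀ y, 0 < ‖E4.spatial (f y) - c‖)
    {u : E3} (hu : ‖u‖ = 1) {y₀ : sphere (0 : E3) 1}
    (hmax : ∀ y, ⟪u, E4.spatial (f y) - c⟫_ℝ / ‖E4.spatial (f y) - c‖ ≤
      ⟪u, E4.spatial (f y₀) - c⟫_ℝ / ‖E4.spatial (f y₀) - c‖)
    (hlt : |⟪u, E4.spatial (f y₀) - c⟫_ℝ / ‖E4.spatial (f y₀) - c‖| < 1) : False := by
  set z₀ : E3 := E4.spatial (f y₀) - c with hz₀
  set r₀ : ℝ := ‖z₀‖ with hr₀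
  have hr₀pos : 0 < r₀ := hr y₀
  set η₀ : ℝ := ⟪u, z₀⟫_ℝ / r₀ with hη₀
  set ω₀ : E3 := r₀⁻¹ • z₀ with hω₀
  have hω₀u : ⟪u, ω₀⟫_ℝ = η₀ := by
    rw [hω₀, real_inner_smul_right, hη₀, div_eq_inv_mul]
  have hω₀1 : ‖ω₀‖ = 1 := by
    rw [hω₀, norm_smul, norm_inv, Real.norm_eq_abs, abs_of_pos hr₀pos, inv_mul_cancel₀ hr₀pos.ne']
  have hzω₀ : ⟪z₀, ω₀⟫_ℝ = r₀ := by
    rw [hω₀, real_inner_smul_right, real_inner_self_eq_norm_sq, ← hr₀]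
    field_simp
  set W : EuclideanSpace ℝ (Fin 2) →L[ℝ] E4 := mfderiv (𝓡 2) 𝓘(ℝ, E4) f y₀ with hW
  have h0 : f y₀ 0 + ρ = r₀ := hcone y₀
  -- (i) the cone condition differentiated: `r₀ W⁰ = ⟪z₀, W̲⟫`
  have hproj : HasFDerivAt (fun x : E4 ↦ x 0 + ρ) (EuclideanSpace.proj (𝕜 := ℝ) (0 : Fin 4))
      (f y₀) :=
    ((EuclideanSpace.proj (𝕜 := ℝ) (0 : Fin 4)).hasFDerivAt).add_const ρ
  have hsp : HasFDerivAt (fun x : E4 ↦ E4.spatial x - c) E4.spatial (f y₀) :=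
    E4.spatial.hasFDerivAt.sub_const c
  have hΨ : HasFDerivAt (fun x : E4 ↦ (x 0 + ρ) * (x 0 + ρ) - ‖E4.spatial x - c‖ ^ 2)
      (((f y₀ 0 + ρ) • EuclideanSpace.proj (𝕜 := ℝ) (0 : Fin 4) +
        (f y₀ 0 + ρ) • EuclideanSpace.proj (𝕜 := ℝ) (0 : Fin 4)) -
        2 • (innerSL ℝ (E4.spatial (f y₀) - c)).comp E4.spatial) (f y₀) :=
    (hproj.mul hproj).sub hsp.norm_sq
  have hi : ∀ w, r₀ * (W w) 0 = ⟪z₀, E4.spatial (W w)⟫_ℝ := by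
    intro w
    have hΨmax : ∀ y, (fun x : E4 ↦ (x 0 + ρ) * (x 0 + ρ) - ‖E4.spatial x - c‖ ^ 2) (f y) ≤
        (fun x : E4 ↦ (x 0 + ρ) * (x 0 + ρ) - ‖E4.spatial x - c‖ ^ 2) (f y₀) := by
      intro y
      simp only [hcone y, hcone y₀, ← pow_two, sub_self, le_refl]
    have h := fermat_sphere hf hΨ hΨmax w
    rw [← hW] at h
    simp only [_root_.sub_apply, _root_.add_apply, _root_.smul_apply,
      ContinuousLinearMap.comp_apply, innerSL_apply_apply, smul_eq_mul, nsmul_eq_mul,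
      PiLp.proj_apply, h0] at h
    change r₀ * (W w) 0 + r₀ * (W w) 0 - 2 * ⟪z₀, E4.spatial (W w)⟫_ℝ = 0 at h
    linarith
  -- (ii) maximality differentiated: `⟪u, W̲⟫ = η₀ W⁰`
  have hΦ : HasFDerivAt (fun x : E4 ↦ ⟪u, E4.spatial x - c⟫_ℝ - η₀ * (x 0 + ρ))
      ((innerSL ℝ u).comp E4.spatial - η₀ • EuclideanSpace.proj (𝕜 := ℝ) (0 : Fin 4)) (f y₀) :=
    ((innerSL ℝ u).hasFDerivAt.comp (f y₀) hsp).sub (hproj.const_mul η₀)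
  have hii : ∀ w, ⟪u, E4.spatial (W w)⟫_ℝ = η₀ * (W w) 0 := by
    intro w
    have hΦmax : ∀ y, (fun x : E4 ↦ ⟪u, E4.spatial x - c⟫_ℝ - η₀ * (x 0 + ρ)) (f y) ≤
        (fun x : E4 ↦ ⟪u, E4.spatial x - c⟫_ℝ - η₀ * (x 0 + ρ)) (f y₀) := by
      intro y
      have hry : 0 < ‖E4.spatial (f y) - c‖ := hr y
      have hy := hmax y
      simp only [hcone y, h0]
      rw [div_le_iff₀ hry] at hy
      have : η₀ * r₀ = ⟪u, z₀⟫_ℝ := by rw [hη₀]; field_simp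
      rw [this, sub_self]
      change ⟪u, E4.spatial (f y) - c⟫_ℝ - η₀ * ‖E4.spatial (f y) - c‖ ≤ 0
      linarith
    have h := fermat_sphere hf hΦ hΦmax w
    rw [← hW] at h
    simp only [_root_.sub_apply, _root_.smul_apply, ContinuousLinearMap.comp_apply,
      innerSL_apply_apply, smul_eq_mul, PiLp.proj_apply] at h
    change ⟪u, E4.spatial (W w)⟫_ℝ - η₀ * (W w) 0 = 0 at h
    linarith
  -- combine: `W̲ ⊥ a`, `a := u - η₀ ω₀ ≠ 0`
  have hav : ∀ w, ⟪u - η₀ • ω₀, E4.spatial (W w)⟫_ℝ = 0 := by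
    intro w
    rw [inner_sub_left, real_inner_smul_left, hii w, hω₀, real_inner_smul_left, ← hi w]
    field_simp
    ring
  have hη₀1 : η₀ ^ 2 < 1 := by
    have : |η₀| < 1 := hlt
    nlinarith [abs_nonneg η₀, sq_abs η₀]
  have ha : u - η₀ • ω₀ ≠ 0 := by
    intro ha0
    have : ‖u - η₀ • ω₀‖ ^ 2 = 1 - η₀ ^ 2 := by
      rw [norm_sub_sq_real, hu, real_inner_smul_right, hω₀u, norm_smul, hω₀1, Real.norm_eq_abs,
        mul_one, sq_abs]
      ring
    rw [ha0, norm_zero] at this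
    nlinarith
  -- the spatial differential lands in the plane `a^⊥`; injective there, hence onto
  let Wsp : EuclideanSpace ℝ (Fin 2) →ₗ[ℝ] E3 :=
    (E4.spatial : E4 →L[ℝ] E3).toLinearMap.comp (W : _ →L[ℝ] E4).toLinearMap
  have hWsp : ∀ w, Wsp w = E4.spatial (W w) := fun _ ↦ rfl
  have hmem : ∀ w, Wsp w ∈ (ℝ ∙ (u - η₀ • ω₀))ᗮ := fun w ↦
    Submodule.mem_orthogonal_singleton_iff_inner_right.2 (hav w)
  let Wc : EuclideanSpace ℝ (Fin 2) →ₗ[ℝ] (ℝ ∙ (u - η₀ • ω₀))ᗮ := Wsp.codRestrict _ hmem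
  have hker : ∀ w, E4.spatial (W w) = 0 → w = 0 := by
    intro w hw0
    by_contra hne
    have hp := hpos y₀ w hne
    have ht : (W w) 0 = 0 := by
      have := hi w
      rw [hw0, inner_zero_right] at this
      exact (mul_eq_zero.1 this).resolve_left hr₀pos.ne'
    rw [bilin_self_eq] at hp
    change 0 < -(W w 0) ^ 2 + ‖E4.spatial (W w)‖ ^ 2 at hp
    rw [ht, hw0, norm_zero] at hp
    norm_num at hp
  have hinj : Function.Injective Wc := by
    intro w₁ w₂ h
    have h' : E4.spatial (W w₁) = E4.spatial (W w₂) := by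
      have := congrArg Subtype.val h
      exact this
    have : w₁ - w₂ = 0 := hker _ (by rw [map_sub, map_sub, h', sub_self])
    exact sub_eq_zero.1 this
  haveI : Fact (Module.finrank ℝ E3 = 2 + 1) := ⟨finrank_euclideanSpace_fin⟩
  have hfin : Module.finrank ℝ (EuclideanSpace ℝ (Fin 2)) =
      Module.finrank ℝ (ℝ ∙ (u - η₀ • ω₀))ᗮ := by
    rw [Submodule.finrank_orthogonal_span_singleton (n := 2) ha, finrank_euclideanSpace_fin]
  have hsurj := (LinearMap.injective_iff_surjective_of_finrank_eq_finrank hfin).1 hinj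
  have hω₀mem : ω₀ ∈ (ℝ ∙ (u - η₀ • ω₀))ᗮ := by
    refine Submodule.mem_orthogonal_singleton_iff_inner_right.2 ?_
    rw [inner_sub_left, real_inner_smul_left, hω₀u, real_inner_self_eq_norm_sq, hω₀1]
    ring
  obtain ⟨w, hw⟩ := hsurj ⟨ω₀, hω₀mem⟩
  have hw' : E4.spatial (W w) = ω₀ := by
    have := congrArg Subtype.val hw
    exact this
  have ht : (W w) 0 = 1 := by
    have := hi w
    rw [hw', hzω₀] at this
    field_simp at this
    linarith
  have hw0 : w ≠ 0 := by
    rintro rfl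
    rw [map_zero, map_zero] at hw'
    have := congrArg norm hw'
    rw [norm_zero, hω₀1] at this
    exact zero_ne_one this
  have := hpos y₀ w hw0
  rw [bilin_self_eq] at this
  change 0 < -(W w 0) ^ 2 + ‖E4.spatial (W w)‖ ^ 2 at this
  rw [hw', hω₀1, ht] at this
  norm_num at this

/-- **A spacelike sphere on a light cone sees every direction.** Under the hypotheses of
`not_isMax_dirCosine`, for every unit `u` (with some unit `u₂ ⊥ u` at hand) some point of the sphere
is mapped onto the ray from `c` in the direction `u`: `f̲ y - c = ‖f̲ y - c‖ u`. The direction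
cosine against `u` attains its maximum on the compact sphere; the maximum is `1` (the claim, by the
equality case of Cauchy–Schwarz), or lies in `(-1, 1)` (excluded by `not_isMax_dirCosine`), or is
`-1`, in which case every direction is `-u`, the direction cosine against `u₂` vanishes identically,
and `not_isMax_dirCosine` applies to `u₂` at any point. [folklore] -/
theorem exists_spatial_sub_eq_smul {f : sphere (0 : E3) 1 → E4}
    (hf : ContMDiff (𝓡 2) 𝓘(ℝ, E4) 1 f)
    (hpos : ∀ y (w : EuclideanSpace ℝ (Fin 2)), w ≠ 0 →
      0 < bilin (mfderiv (𝓡 2) 𝓘(ℝ, E4) f y w) (mfderiv (𝓡 2) 𝓘(ℝ, E4) f y w))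
    {c : E3} {ρ : ℝ} (hcone : ∀ y, f y 0 + ρ = ‖E4.spatial (f y) - c‖)
    (hr : ∀ y, 0 < ‖E4.spatial (f y) - c‖) {u u₂ : E3} (hu : ‖u‖ = 1) (hu₂ : ‖u₂‖ = 1)
    (horth : ⟪u, u₂⟫_ℝ = 0) :
    ∃ y, E4.spatial (f y) - c = ‖E4.spatial (f y) - c‖ • u := by
  have hcont : Continuous f := hf.continuous
  set h : sphere (0 : E3) 1 → ℝ :=
    fun y ↦ ⟪u, E4.spatial (f y) - c⟫_ℝ / ‖E4.spatial (f y) - c‖ with hh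
  have hzc : Continuous fun y ↦ E4.spatial (f y) - c :=
    (E4.spatial.continuous.comp hcont).sub continuous_const
  have hhc : Continuous h := (continuous_const.inner hzc).div hzc.norm fun y ↦ (hr y).ne'
  have hne : (univ : Set (sphere (0 : E3) 1)).Nonempty := by
    obtain ⟨y, hy⟩ := (NormedSpace.sphere_nonempty (E := E3) (x := 0) (r := 1)).2 zero_le_one
    exact ⟨⟨y, hy⟩, mem_univ _⟩
  obtain ⟨y₀, -, hy₀⟩ := isCompact_univ.exists_isMaxOn hne hhc.continuousOn
  have hmax : ∀ y, h y ≤ h y₀ := fun y ↦ hy₀ (mem_univ y)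
  have hle : ∀ y, |h y| ≤ 1 := fun y ↦ by
    simp only [hh]
    rw [abs_div, abs_norm, div_le_one (hr y)]
    calc |⟪u, E4.spatial (f y) - c⟫_ℝ| ≤ ‖u‖ * ‖E4.spatial (f y) - c‖ :=
          abs_real_inner_le_norm _ _
      _ = ‖E4.spatial (f y) - c‖ := by rw [hu, one_mul]
  -- direction cosine `σ` against `u` at `y` forces the direction `σ = ±1 ⇒ z = ± ‖z‖ u`
  have key : ∀ (v : E3), ‖v‖ = 1 → ∀ y, ⟪v, E4.spatial (f y) - c⟫_ℝ / ‖E4.spatial (f y) - c‖ = 1 →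
      E4.spatial (f y) - c = ‖E4.spatial (f y) - c‖ • v := by
    intro v hv y hy
    rw [div_eq_iff (hr y).ne', one_mul] at hy
    have hz : ⟪v, E4.spatial (f y) - c⟫_ℝ = ‖v‖ * ‖E4.spatial (f y) - c‖ := by rw [hv, one_mul, hy]
    have := (inner_eq_norm_mul_iff_real).1 hz
    rw [hv, one_smul] at this
    exact this.symm
  by_cases h1 : h y₀ = 1
  · exact ⟨y₀, key u hu y₀ h1⟩
  exfalso
  by_cases h2 : h y₀ = -1
  · -- all directions are `-u`; the direction cosine against `u₂` vanishes identically
    have hall : ∀ y, h y = -1 := fun y ↦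
      le_antisymm (h2 ▸ hmax y) (abs_le.1 (hle y)).1
    have hdir : ∀ y, E4.spatial (f y) - c = ‖E4.spatial (f y) - c‖ • (-u) := by
      intro y
      refine key (-u) (by rw [norm_neg, hu]) y ?_
      have := hall y
      simp only [hh] at this
      rw [inner_neg_left, neg_div, this, neg_neg]
    have h2zero : ∀ y, ⟪u₂, E4.spatial (f y) - c⟫_ℝ / ‖E4.spatial (f y) - c‖ = 0 := by
      intro y
      rw [hdir y, real_inner_smul_right, inner_neg_right, real_inner_comm, horth]
      simp
    refine not_isMax_dirCosine hf hpos hcone hr hu₂ (y₀ := y₀) (fun y ↦ ?_) ?_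
    · rw [h2zero y, h2zero y₀]
    · rw [h2zero y₀, abs_zero]; exact one_pos
  · refine not_isMax_dirCosine hf hpos hcone hr hu (y₀ := y₀) hmax ?_
    rcases (hle y₀).lt_or_eq with hlt | heq
    · exact hlt
    · rcases abs_eq (zero_le_one' ℝ) |>.1 heq with h' | h'
      · exact (h1 h').elim
      · exact (h2 h').elim

/-! ### Assembly: the kissing balls carry no round section family -/

/-- **One side of the kissing-ball cone carries no spacelike sphere with tangent rays.** If every
point of a `C¹` `η`-spacelike sphere `f : S² → ℝ⁴` lies on the cone `{x⁰ = T(x̲)}` of the balls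
about `c` and `c' = c + 2ρ u`, carries a tangent ray, and lies strictly on the side of `c` (`d_c <
d_{c'}`), we reach a contradiction: every point is outside the ball about `c` on its light cone
(`IsTangentRay.le_norm_sub`), so by `exists_spatial_sub_eq_smul` some point lies radially beyond `c`
in the direction `u` of `c'`, `f̲ y = c + r u`, `r ≥ ρ` — where `d_{c'} = (|r - 2ρ| - ρ)⁺ ≤ r - ρ =
d_c`. (Geometrically: the generator of the ball about `c` issuing from the contact point towards
`c'` enters the interior of `J⁺(K)` at once, yet the section would have to cross it.) [folklore] -/
theorem side_false {f : sphere (0 : E3) 1 → E4} (hf : ContMDiff (𝓡 2) 𝓘(ℝ, E4) 1 f)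
    (hpos : ∀ y (w : EuclideanSpace ℝ (Fin 2)), w ≠ 0 →
      0 < bilin (mfderiv (𝓡 2) 𝓘(ℝ, E4) f y w) (mfderiv (𝓡 2) 𝓘(ℝ, E4) f y w))
    {ρ : ℝ} (hρ : 0 < ρ) {c u u₂ : E3} (hu : ‖u‖ = 1) (hu₂ : ‖u₂‖ = 1) (horth : ⟪u, u₂⟫_ℝ = 0)
    (hray : ∀ y, ∃ v : E3, ‖v‖ = 1 ∧ IsTangentRay ρ c (c + (2 * ρ) • u) (E4.spatial (f y)) v ∧
      arrival ρ c (c + (2 * ρ) • u) (E4.spatial (f y)) = f y 0)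
    (hside : ∀ y,
      ballDist ρ c (E4.spatial (f y)) < ballDist ρ (c + (2 * ρ) • u) (E4.spatial (f y))) :
    False := by
  set c' := c + (2 * ρ) • u with hc'
  have hout : ∀ y, ρ ≤ ‖E4.spatial (f y) - c‖ := fun y ↦ by
    obtain ⟨v, hv, hR, -⟩ := hray y
    exact (hR.le_norm_sub hρ hv (hside y)).1
  have hr : ∀ y, 0 < ‖E4.spatial (f y) - c‖ := fun y ↦ hρ.trans_le (hout y)
  have hcone : ∀ y, f y 0 + ρ = ‖E4.spatial (f y) - c‖ := fun y ↦ by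
    obtain ⟨v, hv, hR, ha⟩ := hray y
    rw [← ha, arrival, min_eq_left (hside y).le, ballDist_of_le (hout y)]
    ring
  obtain ⟨y, hy⟩ := exists_spatial_sub_eq_smul hf hpos hcone hr hu hu₂ horth
  set r := ‖E4.spatial (f y) - c‖ with hr_def
  have hρr : ρ ≤ r := hout y
  have h1 : ballDist ρ c (E4.spatial (f y)) = r - ρ := ballDist_of_le hρr
  have h2 : ballDist ρ c' (E4.spatial (f y)) ≤ r - ρ := by
    have hz : E4.spatial (f y) - c' = (r - 2 * ρ) • u := by
      rw [hc', ← sub_sub, hy, sub_smul]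
    refine max_le ?_ (by linarith)
    rw [hz, norm_smul, hu, mul_one, Real.norm_eq_abs]
    have : |r - 2 * ρ| ≤ r := abs_le.2 ⟨by linarith, by linarith⟩
    linarith
  have := hside y
  rw [h1] at this
  exact absurd (h2.trans_lt this) (lt_irrefl _)

/-- **The future null cone of two kissing balls carries no round section family.** For `ρ > 0`, a
point `p` and orthonormal `e, e₂ ∈ ℝ³`, there is NO `CauchyDevelopment.RoundSectionFamily` on
`∂J⁺(K)`, `K = {0} × (B̄(p, ρ) ∪ B̄(p + 2ρ e, ρ))`, in the Minkowski development — indeed not a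
single smooth spacelike sphere in `∂J⁺(K)` whose outgoing null normal is tangent to null geodesics
running inside `∂J⁺(K)`. Proof: by `exists_pointData` and `cone_kissingBalls_subset` every point `x`
of a section lies on the graph `{x⁰ = T(x̲)}` and carries the tangent ray `L̲/L⁰`; hence
(`IsTangentRay.ballDist_ne`) no point is a crossing point `{d_p = d_q}`, and the connected section
lies in one of the two open sides; on either side `side_false` applies (with `u = e`, resp. `u =
-e`, and `u₂ = e₂`). Only the fields `sec`, `range_sec_subset`, `isSpacelike`, `pair`, `tangent_L`
of the structure are used (not `tendsto_area`, `round`, `isSmoothEmbedding`): the obstruction is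
local-to-global and first order, unlike the `C¹`-but-not-`C²` junction obstruction on the cone of a
spacelike segment. [folklore] -/
theorem isEmpty_roundSectionFamily_kissingBalls {ρ : ℝ} (hρ : 0 < ρ) (p : E3) {e e₂ : E3}
    (he : ‖e‖ = 1) (he₂ : ‖e₂‖ = 1) (horth : ⟪e, e₂⟫_ℝ = 0) :
    IsEmpty (CauchyDevelopment.RoundSectionFamily
      Minkowski.vacuumCauchyDevelopment.toCauchyDevelopment
      (kissingBalls ρ p (p + (2 * ρ) • e))) := by
  refine ⟨fun 𝓕 ↦ ?_⟩
  set q : E3 := p + (2 * ρ) • e with hq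
  have hpq : p ≠ q := by
    intro h
    have : (2 * ρ) • e = 0 := by
      have := congrArg (fun z ↦ z - p) h
      simpa [hq] using this.symm
    rw [smul_eq_zero] at this
    rcases this with h0 | h0
    · linarith
    · rw [h0, norm_zero] at he; exact zero_ne_one he
  set f : sphere (0 : E3) 1 → E4 := 𝓕.sec 0 with hf
  have hfC : ContMDiff (𝓡 2) 𝓘(ℝ, E4) 1 f := (𝓕.isSpacelike 0).1.of_le le_add_self
  have hpos : ∀ y (w : EuclideanSpace ℝ (Fin 2)), w ≠ 0 →
      0 < bilin (mfderiv (𝓡 2) 𝓘(ℝ, E4) f y w) (mfderiv (𝓡 2) 𝓘(ℝ, E4) f y w) :=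
    fun y w hw ↦ (𝓕.isSpacelike 0).2 y w hw
  -- tangent rays at every point, from the null generators through the section
  have hray : ∀ y, ∃ v : E3, ‖v‖ = 1 ∧ IsTangentRay ρ p q (E4.spatial (f y)) v ∧
      arrival ρ p q (E4.spatial (f y)) = f y 0 := by
    intro y
    obtain ⟨x, L, hx, -, hxc, ⟨ε, hε, hline⟩, hLL, hL0⟩ := exists_pointData 𝓕 0 y
    have hxf : f y = x := hx.symm
    have hLsp : ‖E4.spatial L‖ = L 0 := by
      rw [bilin_self_eq] at hLL
      have h3 : ‖E4.spatial L‖ ^ 2 = (L 0) ^ 2 := by linarith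
      nlinarith [norm_nonneg (E4.spatial L), sq_nonneg (‖E4.spatial L‖ - L 0),
        sq_nonneg (‖E4.spatial L‖ + L 0)]
    have hx0 : arrival ρ p q (E4.spatial x) = x 0 := cone_kissingBalls_subset hρ.le p q hxc
    refine ⟨(L 0)⁻¹ • E4.spatial L, ?_, ⟨ε * L 0, by positivity, fun s hs ↦ ?_⟩, by rw [hxf, hx0]⟩
    · rw [norm_smul, norm_inv, Real.norm_eq_abs, abs_of_pos hL0, hLsp, inv_mul_cancel₀ hL0.ne']
    · have ht : s / L 0 ∈ Ioo 0 ε :=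
        ⟨div_pos hs.1 hL0, (div_lt_iff₀ hL0).2 hs.2⟩
      have hmem : arrival ρ p q (E4.spatial (x + (s / L 0) • L)) = (x + (s / L 0) • L) 0 :=
        cone_kissingBalls_subset hρ.le p q (hline _ ht)
      rw [map_add, map_smul] at hmem
      rw [hxf, hx0, smul_smul, show s * (L 0)⁻¹ = s / L 0 from rfl, hmem]
      simp only [PiLp.add_apply, PiLp.smul_apply, smul_eq_mul]
      rw [div_mul_cancel₀ _ hL0.ne']
  -- no point is a crossing point; the (connected) section lies on one side
  have hU : IsOpen {x : E4 | ballDist ρ p (E4.spatial x) < ballDist ρ q (E4.spatial x)} :=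
    isOpen_lt ((continuous_ballDist ρ p).comp E4.spatial.continuous)
      ((continuous_ballDist ρ q).comp E4.spatial.continuous)
  have hV : IsOpen {x : E4 | ballDist ρ q (E4.spatial x) < ballDist ρ p (E4.spatial x)} :=
    isOpen_lt ((continuous_ballDist ρ q).comp E4.spatial.continuous)
      ((continuous_ballDist ρ p).comp E4.spatial.continuous)
  have hUV : Disjoint {x : E4 | ballDist ρ p (E4.spatial x) < ballDist ρ q (E4.spatial x)}
      {x : E4 | ballDist ρ q (E4.spatial x) < ballDist ρ p (E4.spatial x)} :=
    Set.disjoint_left.2 fun x (hx : ballDist ρ p (E4.spatial x) < ballDist ρ q (E4.spatial x))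
      (hx' : ballDist ρ q (E4.spatial x) < ballDist ρ p (E4.spatial x)) ↦ lt_asymm hx hx'
  have hcover : range f ⊆ {x : E4 | ballDist ρ p (E4.spatial x) < ballDist ρ q (E4.spatial x)} ∪
      {x : E4 | ballDist ρ q (E4.spatial x) < ballDist ρ p (E4.spatial x)} := by
    rintro _ ⟨y, rfl⟩
    obtain ⟨v, hv, hR, -⟩ := hray y
    exact (lt_or_gt_of_ne (hR.ballDist_ne hρ hpq hv)).imp id id
  haveI : PreconnectedSpace (sphere (0 : E3) 1) :=
    Subtype.preconnectedSpace (isPreconnected_sphere (by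
      rw [← Module.finrank_eq_rank, finrank_euclideanSpace_fin]; norm_num) 0 1)
  rcases (isPreconnected_range hfC.continuous).subset_or_subset hU hV hUV hcover with hS | hS
  · exact side_false hfC hpos hρ he he₂ horth hray fun y ↦ hS ⟨y, rfl⟩
  · have hp : p = q + (2 * ρ) • (-e) := by rw [hq, smul_neg]; abel
    refine side_false hfC hpos hρ (c := q) (u := -e) (u₂ := e₂) (by rw [norm_neg, he]) he₂
      (by rw [inner_neg_left, horth, neg_zero]) (fun y ↦ ?_) fun y ↦ ?_
    · obtain ⟨v, hv, hR, ha⟩ := hray y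
      rw [← hp]
      exact ⟨v, hv, hR.symm, by rw [arrival_comm, ha]⟩
    · rw [← hp]
      exact hS ⟨y, rfl⟩

/-- **The cut of `𝓘⁺` by the cone of two kissing balls has no Bondi energy in any frame**:
`HasCutBondiMass (∂J⁺(K)) m` fails for every `m`, there being no round receding family of sections
of `∂J⁺(K)` at all (`isEmpty_roundSectionFamily_kissingBalls`). [folklore] -/
theorem not_hasCutBondiMass_kissingBalls {ρ : ℝ} (hρ : 0 < ρ) (p : E3) {e e₂ : E3}
    (he : ‖e‖ = 1) (he₂ : ‖e₂‖ = 1) (horth : ⟪e, e₂⟫_ℝ = 0) (m : ℝ) :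
    ¬ Minkowski.vacuumCauchyDevelopment.toCauchyDevelopment.HasCutBondiMass
      (kissingBalls ρ p (p + (2 * ρ) • e)) m := by
  rintro ⟨𝓕, -⟩
  exact (isEmpty_roundSectionFamily_kissingBalls hρ p he he₂ horth).false 𝓕

/-! ### The remaining clauses of the witness -/

/-- Points of Minkowski spacetime with equal spatial parts and increasing times are chronologically
related: the vertical segment `σ ↦ k + σ (x - k)` is a future-directed timelike curve. O'Neill 1983,
Ch. 14, p. 402 (`I⁺(p)` in `ℝ⁴₁`). [cite: ONeillSemiRiemannian1983, Ch. 14, p. 402] -/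
theorem mem_chronologicalFuture_of_spatial_eq {k x : E4} (hsp : E4.spatial x = E4.spatial k)
    (ht : k 0 < x 0) :
    x ∈ (Minkowski.vacuumCauchyDevelopment.metric.chronologicalFuture
      Minkowski.vacuumCauchyDevelopment.timeOrientation {k} : Set E4) := by
  set v : E4 := x - k with hv
  have hv0 : 0 < v 0 := by simp only [hv, PiLp.sub_apply]; linarith
  have hvs : E4.spatial v = 0 := by rw [hv, map_sub, hsp, sub_self]
  have htl : bilin v v < 0 := by rw [bilin_self_eq, hvs, norm_zero]; nlinarith
  have hvne : v ≠ 0 := fun h ↦ by rw [h] at hv0; simp at hv0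
  refine ⟨k, rfl, fun σ : ℝ ↦ k + σ • v, 0, 1, zero_lt_one, fun σ _ ↦ ?_, by simp, by simp [hv]⟩
  have hγ : HasDerivAt (fun σ : ℝ ↦ k + σ • v) v σ := by
    simpa using ((hasDerivAt_id σ).smul_const v).const_add k
  have hmd : MDifferentiableAt 𝓘(ℝ, ℝ) 𝓘(ℝ, E4) (fun σ : ℝ ↦ k + σ • v) σ :=
    mdifferentiableAt_iff_differentiableAt.mpr hγ.differentiableAt
  have hvel : velocity 𝓘(ℝ, E4) (fun σ : ℝ ↦ k + σ • v) σ = v := ModelSpace.velocity_line k v σ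
  refine ⟨hmd, ?_, ⟨?_, ?_⟩, ?_⟩
  · change bilin (velocity 𝓘(ℝ, E4) (fun σ : ℝ ↦ k + σ • v) σ)
      (velocity 𝓘(ℝ, E4) (fun σ : ℝ ↦ k + σ • v) σ) < 0
    rw [hvel]; exact htl
  · change bilin (velocity 𝓘(ℝ, E4) (fun σ : ℝ ↦ k + σ • v) σ)
      (velocity 𝓘(ℝ, E4) (fun σ : ℝ ↦ k + σ • v) σ) ≤ 0
    rw [hvel]; exact htl.le
  · change velocity 𝓘(ℝ, E4) (fun σ : ℝ ↦ k + σ • v) σ ≠ 0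
    rw [hvel]; exact hvne
  · change bilin (E4.basisVector 0) (velocity 𝓘(ℝ, E4) (fun σ : ℝ ↦ k + σ • v) σ) < 0
    rw [hvel, bilin_basisVector_zero_left]
    linarith

/-- The straight null ray `s ↦ (0, p) + s (1, e) = (s, p + s e)` from the slice point `(0, p)` in
the spatial direction `e`. [folklore] -/
def nullRay (p e : E3) : ℝ → E4 := fun s ↦ E4.ofTimeSpace 0 p + s • E4.ofTimeSpace 1 e

/-- `nullRay p e s = (s, p + s e)`. [folklore] -/
theorem nullRay_apply (p e : E3) (s : ℝ) :
    nullRay p e s = E4.ofTimeSpace s (p + s • e) := by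
  ext i
  refine Fin.cases ?_ (fun j ↦ ?_) i
  · simp [nullRay]
  · simp [nullRay]

/-- **The null rays `s ↦ (s, p + s e)`, `‖e‖ = 1`, are normalised future null rays of the Minkowski
development** from the points of the slice, with affine domain all of `ℝ`: maximal geodesics
(straight lines, trivially inextendible beyond `ℝ`), starting at `ι p = (0, p)`, with future null
velocity `L = (1, e)` normalised against the unit normal `∂ₜ` by `η(L, ∂ₜ) = -1`. Christodoulou, CQG
16 (1999), p. A26 (the normalisation); O'Neill 1983, Ch. 3, Example 25 (geodesics of `ℝ⁴₁`). [cite: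
Christodoulou1999, p. A26] -/
theorem isNormalisedNullRayFrom_nullRay
    [inst : Minkowski.vacuumCauchyDevelopment.metric.HasLeviCivita]
    (p : E3) {e : E3} (he : ‖e‖ = 1) :
    Minkowski.vacuumCauchyDevelopment.metric.IsNormalisedNullRayFrom
      Minkowski.vacuumCauchyDevelopment.timeOrientation Minkowski.vacuumCauchyDevelopment.embed
      Minkowski.vacuumCauchyDevelopment.normal ⟨p, mem_slice p⟩ (nullRay p e) univ := by
  haveI : Minkowski.smoothMetric.toPseudoRiemannianMetric.HasLeviCivita := inst
  have hv : velocity 𝓘(ℝ, E4) (nullRay p e) 0 = E4.ofTimeSpace 1 e :=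
    ModelSpace.velocity_line _ _ 0
  have hnull : bilin (E4.ofTimeSpace 1 e) (E4.ofTimeSpace 1 e) = 0 := by
    rw [bilin_self_eq, E4.spatial_ofTimeSpace, E4.ofTimeSpace_apply_zero, he]; norm_num
  have hne : E4.ofTimeSpace 1 e ≠ 0 := fun h ↦ by
    have := congrArg (fun x : E4 ↦ x 0) h
    simp at this
  have ht : bilin (E4.basisVector 0) (E4.ofTimeSpace 1 e) = -1 := by
    rw [bilin_basisVector_zero_left, E4.ofTimeSpace_apply_zero]
  have hgeo : IsGeodesic Minkowski.smoothMetric.toPseudoRiemannianMetric.leviCivita (nullRay p e) :=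
    ModelSpace.isGeodesic_line smoothMetric_val _ _
  refine ⟨⟨isOpen_univ, ordConnected_univ, hgeo, fun γ' s' _ _ hsub _ _ ↦
    eq_univ_of_univ_subset hsub⟩, mem_univ _, by simp [nullRay], ?_, ?_, ?_⟩
  · change bilin (velocity 𝓘(ℝ, E4) (nullRay p e) 0) (velocity 𝓘(ℝ, E4) (nullRay p e) 0) = 0 ∧
      velocity 𝓘(ℝ, E4) (nullRay p e) 0 ≠ 0
    rw [hv]
    exact ⟨hnull, hne⟩
  · change (bilin (velocity 𝓘(ℝ, E4) (nullRay p e) 0) (velocity 𝓘(ℝ, E4) (nullRay p e) 0) ≤ 0 ∧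
        velocity 𝓘(ℝ, E4) (nullRay p e) 0 ≠ 0) ∧
      bilin (E4.basisVector 0) (velocity 𝓘(ℝ, E4) (nullRay p e) 0) < 0
    rw [hv, hnull, ht]
    exact ⟨⟨le_rfl, hne⟩, by norm_num⟩
  · change bilin (velocity 𝓘(ℝ, E4) (nullRay p e) 0) (E4.basisVector 0) = -1
    rw [hv, bilin_symm, ht]

/-- **Every slice point `(0, p + t e)`, `t > 0`, is visible from infinity** in the Minkowski
development: it lies in the chronological past of the point `(t, p + t e)` of the future-complete
normalised null ray from `(0, p)` in the direction `e`, hence in the visible region `I⁻(𝓘⁺)`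
(`DataEmbedding.visibleRegion`). Wald 1984, §12.1, p. 300 (in Minkowski spacetime `I⁻(𝓘⁺)` is
everything). [cite: Wald1984GR, §12.1, p. 300] -/
theorem ofTimeSpace_mem_visibleRegion [Minkowski.vacuumCauchyDevelopment.metric.HasLeviCivita]
    (p : E3) {e : E3} (he : ‖e‖ = 1) {t : ℝ} (ht : 0 < t) :
    E4.ofTimeSpace 0 (p + t • e) ∈
      (Minkowski.vacuumCauchyDevelopment.toDataEmbedding.visibleRegion : Set E4) := by
  refine ⟨⟨p, mem_slice p⟩, nullRay p e, univ, isNormalisedNullRayFrom_nullRay p he,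
    not_bddAbove_univ, ?_⟩
  have hk : E4.ofTimeSpace 0 (p + t • e) ∈
      (Minkowski.vacuumCauchyDevelopment.metric.chronologicalPast
        Minkowski.vacuumCauchyDevelopment.timeOrientation {nullRay p e t} : Set E4) := by
    refine LorentzianMetric.mem_chronologicalPast_of_mem_chronologicalFuture
      (g := Minkowski.vacuumCauchyDevelopment.metric)
      (mem_chronologicalFuture_of_spatial_eq ?_ ?_)
    · rw [nullRay_apply, E4.spatial_ofTimeSpace, E4.spatial_ofTimeSpace]
    · rw [nullRay_apply, E4.ofTimeSpace_apply_zero, E4.ofTimeSpace_apply_zero]; exact ht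
  have hmem : nullRay p e t ∈ nullRay p e '' (univ ∩ Ici 0) := ⟨t, ⟨mem_univ _, ht.le⟩, rfl⟩
  exact LorentzianMetric.chronologicalFuture_mono (g := Minkowski.vacuumCauchyDevelopment.metric)
    (singleton_subset_iff.2 hmem) hk

/-- The kissing balls lie in the data hypersurface `{t = 0} = ι(ℝ³)`, hence in its causal future
`J⁺(ι ℝ³)`. [folklore] -/
theorem kissingBalls_subset_causalFuture_range (ρ : ℝ) (p q : E3) :
    kissingBalls ρ p q ⊆ (Minkowski.vacuumCauchyDevelopment.metric.causalFuture
      Minkowski.vacuumCauchyDevelopment.timeOrientation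
      (range Minkowski.vacuumCauchyDevelopment.embed) : Set E4) := by
  rintro _ ⟨w, -, rfl⟩
  exact LorentzianMetric.subset_causalFuture Minkowski.vacuumCauchyDevelopment.metric _ _
    ⟨⟨w, mem_slice w⟩, rfl⟩

/-- **Minkowski spacetime, as the vacuum Cauchy development of the trivial data `(ℝ³, δ, 0)`, has
complete future null infinity** in Christodoulou's sojourn sense
(`LorentzianMetric.HasCompleteFutureNullInfinity`): `η` is geodesically complete
(`Minkowski.isGeodesicallyComplete_smoothMetric`, straight lines), so by uniqueness of geodesics
every normalised null ray has affine domain `ℝ`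
(`hasCompleteFutureNullInfinity_of_isNullGeodesicallyComplete`). This is the body of the summit-side
`Summit.FinalStateConjecture.HasCompleteNullInfinity` at the Minkowski development (proved there, in
a crux disproof file, in the same way; Literature cannot import it). Christodoulou, CQG 16 (1999),
p. A27 (Minkowski space has complete `𝓘⁺`). [cite: Christodoulou1999, p. A27] -/
theorem hasCompleteFutureNullInfinity_vacuumCauchyDevelopment
    [inst : Minkowski.vacuumCauchyDevelopment.metric.HasLeviCivita] :
    Minkowski.vacuumCauchyDevelopment.metric.HasCompleteFutureNullInfinity
      Minkowski.vacuumCauchyDevelopment.timeOrientation Minkowski.vacuumCauchyDevelopment.embed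
      Minkowski.vacuumCauchyDevelopment.normal := by
  haveI : Minkowski.smoothMetric.toPseudoRiemannianMetric.HasLeviCivita := inst
  haveI : CovariantDerivative.ContMDiffCovariantDerivative
      Minkowski.vacuumCauchyDevelopment.metric.toPseudoRiemannianMetric.leviCivita 1 :=
    Minkowski.smoothMetric.toPseudoRiemannianMetric.contMDiffCovariantDerivative_leviCivita_one
  refine LorentzianMetric.hasCompleteFutureNullInfinity_of_isNullGeodesicallyComplete
    IsGeodesicOn.eqOn_of_velocity_eq_holds (fun x v _ ↦ ?_) _
  exact Minkowski.isGeodesicallyComplete_smoothMetric x v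

/-- The coordinate vectors of `ℝ³` are unit vectors. [folklore] -/
theorem norm_single_one (i : Fin 3) : ‖(EuclideanSpace.single i (1 : ℝ) : E3)‖ = 1 := by
  rw [PiLp.norm_single, norm_one]

/-- The first two coordinate vectors of `ℝ³` are orthogonal. [folklore] -/
theorem inner_single_zero_one :
    ⟪(EuclideanSpace.single 0 (1 : ℝ) : E3), EuclideanSpace.single 1 (1 : ℝ)⟫_ℝ = 0 := by
  rw [EuclideanSpace.inner_single_left]
  simp

/-- **A late compact visible set without cut energy, modulo maximality of the Minkowski
development.** Granted that Minkowski spacetime is a maximal vacuum Cauchy development of the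
trivial data `(ℝ³, δ, 0)` — hypothesis `hmax : Minkowski.vacuumCauchyDevelopment.IsMaximal`, the
existence half of Choquet-Bruhat–Geroch 1969, Thm. 3, at flat data (hyperbolic uniqueness for the
vacuum equations; not in the tree, where MGHD existence is the named fact
`choquetBruhat_geroch_exists_mghd_cauchy`) — there are an admissible datum (`trivialData ∈
admissibleVacuumData Minkowski.slice`), a maximal vacuum Cauchy development of it with complete
future null infinity (`hasCompleteFutureNullInfinity_vacuumCauchyDevelopment`), and a compact subset
of the causal future of its data hypersurface meeting its visible region — the kissing balls `K =
{0} × (B̄(0, 1) ∪ B̄(2e₁, 1))` — such that `HasCutBondiMass K m` fails for every `m`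
(`not_hasCutBondiMass_kissingBalls`). The statement is VERBATIM the body of the hypothesis
`ConeIrregularLateSetExists` of the negative lemma
`leafBudgetLawsR_false_of_coneIrregularLateSetExists` (namespace
`Summit.FinalStateConjecture.FinalStateConjecture.Theorems.LeafBudgetLawsR.Negative`)
(route `MergerLatticeBudget`, crux `LeafBudgetLawsR`, clause (i)(a): every late compact visible set
has a cut energy), with the summit-side `Summit.FinalStateConjecture.HasCompleteNullInfinity`
unfolded to its body; the two agree definitionally, so `ConeIrregularLateSetExists` follows from
`hmax` by `exact` on this theorem, and `LeafBudgetLawsR` is refuted modulo `hmax`. [folklore] -/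
theorem exists_lateSet_forall_not_hasCutBondiMass_of_isMaximal
    (hmax : Minkowski.vacuumCauchyDevelopment.IsMaximal) :
    ∃ (X : Type) (_ : TopologicalSpace X) (_ : ChartedSpace E3 X)
      (_ : IsManifold (𝓡 3) ((⊤ : ℕ∞) : WithTop ℕ∞) X) (_ : T2Space X)
      (_ : SecondCountableTopology X) (_ : ConnectedSpace X) (D : InitialDataSet (𝓡 3) X)
      (_ : D ∈ admissibleVacuumData X) (𝒟 : VacuumCauchyDevelopment D) (_ : 𝒟.IsMaximal)
      (_ : ∀ [𝒟.toCauchyDevelopment.metric.HasLeviCivita],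
        𝒟.toCauchyDevelopment.metric.HasCompleteFutureNullInfinity
          𝒟.toCauchyDevelopment.timeOrientation 𝒟.toCauchyDevelopment.embed
          𝒟.toCauchyDevelopment.normal)
      (_ : 𝒟.metric.HasLeviCivita) (C : Set 𝒟.carrier),
      IsCompact C ∧ (C ∩ 𝒟.toCauchyDevelopment.toDataEmbedding.visibleRegion).Nonempty ∧
        C ⊆ 𝒟.metric.causalFuture 𝒟.timeOrientation (Set.range 𝒟.embed) ∧
        ∀ m : ℝ, ¬ 𝒟.toCauchyDevelopment.HasCutBondiMass C m := by
  haveI hLC : Minkowski.vacuumCauchyDevelopment.metric.HasLeviCivita :=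
    Minkowski.vacuumCauchyDevelopment.metric.toPseudoRiemannianMetric.hasLeviCivita
  refine ⟨Minkowski.slice, inferInstance, inferInstance, inferInstance, inferInstance,
    inferInstance, inferInstance, trivialData, trivialData_mem_admissibleVacuumData,
    Minkowski.vacuumCauchyDevelopment, hmax,
    fun {_} ↦ hasCompleteFutureNullInfinity_vacuumCauchyDevelopment, hLC,
    kissingBalls 1 0 ((0 : E3) + (2 * 1) • EuclideanSpace.single 0 (1 : ℝ)),
    isCompact_kissingBalls _ _ _, ?_, kissingBalls_subset_causalFuture_range _ _ _,
    not_hasCutBondiMass_kissingBalls one_pos 0 (norm_single_one 0) (norm_single_one 1)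
      inner_single_zero_one⟩
  refine ⟨E4.ofTimeSpace 0 ((0 : E3) + (2 * 1) • EuclideanSpace.single 0 (1 : ℝ)),
    ⟨(0 : E3) + (2 * 1) • EuclideanSpace.single 0 (1 : ℝ), Or.inr (mem_closedBall_self zero_le_one),
      rfl⟩, ?_⟩
  exact ofTimeSpace_mem_visibleRegion 0 (norm_single_one 0) (by norm_num)

end Minkowski

end Literature.Geometry.Lorentzian

end

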